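import Mathlib
import HarnessLib
import Literature.MathematicalPhysics.QuantumFieldTheory.ConstructiveQFTWave0
import Literature.MathematicalPhysics.QuantumLattice.AbelianFieldTensor
import Literature.MathematicalPhysics.QuantumLattice.AbelianMagneticFlux
import Summits.Ventures.LatticeQCDFlow.Scaling.CircleBallVolume
import Summits.Ventures.LatticeQCDFlow.Scaling.TopologicalCollar
import Summits.Ventures.LatticeQCDFlow.Scaling.TunnellingLaws
import Summits.Ventures.LatticeQCDFlow.Scaling.FluxSectorCollar
import Summits.Ventures.LatticeQCDFlow.Scaling.FluxPatch
import Summits.Ventures.LatticeQCDFlow.Scaling.FluxTunnelling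
import Summits.Ventures.LatticeQCDFlow.Scaling.SliceTwistWitness
import Summits.Ventures.LatticeQCDFlow.Scaling.StripWindingWitness

/-!
# LatticeQCDFlow / Scaling — the max-plaquette flux law, products and row fields (v3.6, (C7b″) sharp form, part 2 of 4)

HONEST FRAMING: exact (Metropolis-corrected) sampling algorithms for lattice gauge theory; figures
of merit are autocorrelation/cost numbers at stated couplings and volumes; no continuum-physics
claim.

THEORY-2.md §4 (C7), §5.12, §5.17.  `U(1) = Circle`.

* **§2 (the positive side in the max-plaquette currency, every `d`, every `L ≥ 1`).**  The sharp
  patch law of `FluxTunnelling.lean` (`Σ_{p ∈ P} |F_p| ≥ π` at `U` or at `U'` whenever a `P`-local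
  move changes the plane charge, `pi_le_sum_abs_or_of_topCharge_ne`) in the currency of the metric
  laws: a `μ`-invariant Markov kernel changing only the links of `Λ` changes the `(μ,ν)`-plane charge
  with stationary probability `≤ 2·μ{∃ p ∈ P, dist(U_p, 1) ≥ 2 sin(π/(2·#P))}` for any non-empty
  set `P` of plane positions containing those whose plaquette touches `Λ`
  (`compProd_topCharge_ne_le_of_links_maxPlaquette`; pigeonhole and `‖1 - u_p‖ = 2|sin(F_p/2)|`).
  `BalancedSliceTwist.lean` shows the threshold `2 sin(π/(2·#P))` cannot be raised for a wrapping
  line (`#P = L`).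
* **§3 (products and row fields, `d = 2`).**  Plaquettes — and, while the summed field tensor stays
  in the principal branch, flux charges — are additive under pointwise products
  (`plaquetteHolonomy_mul'`, `topCharge_mul`).  A ROW FIELD `rowField a` (direction-`1` links carrying
  the phase `Σ_{r < x₀} a r`, rates summing to zero over a period) has plaquette `e^{i a(x₀)}` on
  row `x₀` (`plaquetteHolonomy_rowField`), flux charge `L·(Σ_{v<L} a v)/2π = 0` (`topCharge_of_row`,
  `topCharge_rowField`), and is `2 sin(m/2)`-thin when `|a| ≤ m ≤ π` (`dist_plaquette_le_of_eq_exp`):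
  the thin charge-zero BACKGROUNDS against which a twist is balanced in the sequels.
-/

noncomputable section

namespace Summit.Ventures.LatticeQCDFlow.Theory2.Lattice.Flux

open MeasureTheory ProbabilityTheory Metric Set Filter Topology Real
open scoped ENNReal
open Literature.MathematicalPhysics.QuantumFieldTheory Literature.MathematicalPhysics.QuantumLattice

/-! ## §2. The positive side in the max-plaquette currency (every `d`) -/

section MaxPlaquette

variable {d L : ℕ} [NeZero L] (x₀ : Site d L) (μ ν : Fin d)

omit [NeZero L] in
/-- `dist(e^{iθ}, 1) = |2 sin(θ/2)|`. [folklore] -/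
theorem dist_exp_one_eq (θ : ℝ) : dist (Circle.exp θ) 1 = |2 * Real.sin (θ / 2)| := by
  rw [← mul_one (Circle.exp θ), Circle.dist_exp_mul_self]

omit [NeZero L] in
/-- A plaquette angle of size `≤ m ≤ π` is a plaquette within `2 sin(m/2)` of `1`. [folklore] -/
theorem dist_exp_one_le_of_abs_le {θ m : ℝ} (hθ : |θ| ≤ m) (hm : m ≤ π) :
    dist (Circle.exp θ) 1 ≤ 2 * Real.sin (m / 2) := by
  rw [dist_exp_one_eq, abs_mul, abs_two]
  have h0 : 0 ≤ m := (abs_nonneg θ).trans hθ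
  have h1 : |θ / 2| ≤ |m / 2| := by
    rw [abs_div, abs_div, abs_two, abs_of_nonneg h0]; linarith
  have h2 : |m / 2| ≤ π / 2 := by rw [abs_of_nonneg (by linarith)]; linarith
  have h3 := abs_sin_le_abs_sin h1 h2
  rw [abs_of_nonneg (Real.sin_nonneg_of_nonneg_of_le_pi (by linarith) (by linarith) :
    0 ≤ Real.sin (m / 2))] at h3
  linarith

omit [NeZero L] in
/-- The chordal size of a plaquette is `2|sin(F_p/2)|`. [folklore] -/
theorem dist_plaquette_one_eq (U : GaugeConfig d L Circle) (x : Site d L) (i j : Fin d) :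
    dist (plaquetteHolonomy U x i j) 1 = 2 * |Real.sin (abelianFieldTensor U x i j / 2)| := by
  rw [U1.dist_eq_norm_coe, Circle.coe_one, norm_sub_rev, norm_one_sub_coe_plaquette_eq]

omit [NeZero L] in
/-- **Pigeonhole.**  `Σ_{p ∈ P} |F_p| ≥ π` puts some `p ∈ P` at `|F_p| ≥ π/#P`, i.e. at chordal
distance `≥ 2 sin(π/(2·#P))` from `1`. [folklore] -/
theorem exists_dist_ge_of_pi_le_sum {P : Finset (ZMod L × ZMod L)} (hP : P.Nonempty)
    (U : GaugeConfig d L Circle)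
    (hπ : π ≤ ∑ p ∈ P, |abelianFieldTensor U (planeSite x₀ μ ν p) μ ν|) :
    ∃ p ∈ P, 2 * Real.sin (π / (2 * P.card)) ≤
      dist (plaquetteHolonomy U (planeSite x₀ μ ν p) μ ν) 1 := by
  have hcard : (0 : ℝ) < P.card := by exact_mod_cast Finset.card_pos.mpr hP
  obtain ⟨p, hp, hle⟩ : ∃ p ∈ P, π / P.card ≤ |abelianFieldTensor U (planeSite x₀ μ ν p) μ ν| := by
    apply Finset.exists_le_of_sum_le hP
    rw [Finset.sum_const, nsmul_eq_mul, mul_div_cancel₀ _ hcard.ne']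
    exact hπ
  refine ⟨p, hp, ?_⟩
  rw [dist_plaquette_one_eq]
  set F := abelianFieldTensor U (planeSite x₀ μ ν p) μ ν
  have h1 : |π / (2 * P.card)| ≤ |F / 2| := by
    rw [abs_of_nonneg (by positivity), abs_div, abs_two,
      show π / (2 * (P.card : ℝ)) = π / P.card / 2 by ring]
    linarith
  have h2 : |F / 2| ≤ π / 2 := by
    rw [abs_div, abs_two]
    linarith [abs_abelianFieldTensor_le_pi U (planeSite x₀ μ ν p) μ ν]
  have h3 := abs_sin_le_abs_sin h1 h2
  have h4 : π / (2 * (P.card : ℝ)) ≤ π := by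
    rw [div_le_iff₀ (by positivity)]
    have : (1 : ℝ) ≤ P.card := by exact_mod_cast Finset.card_pos.mpr hP
    nlinarith [Real.pi_pos]
  rw [abs_of_nonneg (Real.sin_nonneg_of_nonneg_of_le_pi (by positivity) h4)] at h3
  linarith

/-- **LINK-LOCAL FLUX TUNNELLING LAW, max-plaquette currency.**  A `μ`-invariant Markov kernel whose
steps change only the links of `Λ` changes the `(μ,ν)`-plane charge with stationary probability
`≤ 2·μ{∃ p ∈ P, dist(U_p, 1) ≥ 2 sin(π/(2·#P))}`, for any non-empty set `P` of plane positions
containing those whose plaquette touches `Λ` (from `pi_le_sum_abs_or_of_topCharge_ne`).  Attained: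
`BalancedSliceTwist.lean`. [folklore] -/
theorem compProd_topCharge_ne_le_of_links_maxPlaquette (Λ : Finset (Edge d L))
    {P : Finset (ZMod L × ZMod L)} (hPne : P.Nonempty)
    (hP : ∀ p, (∃ e ∈ plaqLinks (planeSite x₀ μ ν p) μ ν, e ∈ Λ) → p ∈ P)
    (m : Measure (GaugeConfig d L Circle)) [SFinite m]
    (κ : Kernel (GaugeConfig d L Circle) (GaugeConfig d L Circle)) [IsMarkovKernel κ]
    (hinv : κ.Invariant m) (hloc : ∀ᵐ q ∂(m ⊗ₘ κ), ∀ e ∉ Λ, q.1 e = q.2 e) :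
    (m ⊗ₘ κ) {q | topCharge x₀ μ ν q.1 ≠ topCharge x₀ μ ν q.2} ≤
      2 * m {U | ∃ p ∈ P, 2 * Real.sin (π / (2 * P.card)) ≤
        dist (plaquetteHolonomy U (planeSite x₀ μ ν p) μ ν) 1} := by
  refine Tunnelling.compProd_chargeChange_le_of_invariant
    (R := fun U U' : GaugeConfig d L Circle => ∀ p ∉ P,
      plaquetteHolonomy U (planeSite x₀ μ ν p) μ ν = plaquetteHolonomy U' (planeSite x₀ μ ν p) μ ν)
    (Q := topCharge x₀ μ ν)
    (B := {U | ∃ p ∈ P, 2 * Real.sin (π / (2 * P.card)) ≤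
      dist (plaquetteHolonomy U (planeSite x₀ μ ν p) μ ν) 1})
    (fun U U' hUU' hQ => ?_) m κ hinv ?_
  · exact (pi_le_sum_abs_or_of_topCharge_ne x₀ μ ν hUU' hQ).imp
      (exists_dist_ge_of_pi_le_sum x₀ μ ν hPne U) (exists_dist_ge_of_pi_le_sum x₀ μ ν hPne U')
  · filter_upwards [hloc] with q hq
    exact plaquette_eq_off_patch_of_links hP hq

end MaxPlaquette

/-! ## §3. Products and row fields (`d = 2`) -/

section Products

variable {d L : ℕ} [NeZero L]

omit [NeZero L] in
/-- Plaquettes are multiplicative under pointwise products of `U(1)` configurations. [folklore] -/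
theorem plaquetteHolonomy_mul' (U V : GaugeConfig d L Circle) (x : Site d L) (i j : Fin d) :
    plaquetteHolonomy (U * V) x i j = plaquetteHolonomy U x i j * plaquetteHolonomy V x i j := by
  apply Circle.ext
  simp only [plaquetteHolonomy, Pi.mul_apply, Circle.coe_mul, Circle.coe_inv]
  ring

omit [NeZero L] in
/-- The field tensor is additive while the sum stays in the principal branch. [folklore] -/
theorem abelianFieldTensor_mul {U V : GaugeConfig d L Circle} {x : Site d L} {i j : Fin d}
    (h1 : -π < abelianFieldTensor U x i j + abelianFieldTensor V x i j)
    (h2 : abelianFieldTensor U x i j + abelianFieldTensor V x i j ≤ π) :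
    abelianFieldTensor (U * V) x i j = abelianFieldTensor U x i j + abelianFieldTensor V x i j :=
  abelianFieldTensor_eq_of_plaquette_eq_exp
    (by rw [plaquetteHolonomy_mul', Circle.exp_add, exp_abelianFieldTensor, exp_abelianFieldTensor])
    h1 h2

/-- **Flux charges add** under pointwise products whose summed field tensor stays in the principal
branch at every site. [folklore] -/
theorem topCharge_mul (x₀ : Site d L) (μ ν : Fin d) {U V : GaugeConfig d L Circle}
    (h : ∀ x, -π < abelianFieldTensor U x μ ν + abelianFieldTensor V x μ ν ∧
      abelianFieldTensor U x μ ν + abelianFieldTensor V x μ ν ≤ π) :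
    topCharge x₀ μ ν (U * V) = topCharge x₀ μ ν U + topCharge x₀ μ ν V := by
  have h' : ∀ x, abelianFieldTensor (U * V) x μ ν =
      abelianFieldTensor U x μ ν + abelianFieldTensor V x μ ν :=
    fun x => abelianFieldTensor_mul (h x).1 (h x).2
  simp only [topCharge, magneticFlux, h', Finset.sum_add_distrib, add_div]

end Products

section Row

variable {L : ℕ} [NeZero L]

omit [NeZero L] in
/-- Successor representatives on `ZMod L` (`1 < L`) (LANDING NOTE lean-1 GEN-5: condition written `L = y.val + 1` to
avoid a near-duplicate of a QCD-summit lemma; `sum_zmod_val` is taken from `StripWindingWitness`). [folklore] -/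
theorem val_add_one_eq [Fact (1 < L)] (y : ZMod L) :
    (y + 1).val = if L = y.val + 1 then 0 else y.val + 1 := by
  have := ZMod.val_lt y
  rw [ZMod.val_add, ZMod.val_one]
  split_ifs with h
  · rw [← h, Nat.mod_self]
  · exact Nat.mod_eq_of_lt (by omega)

/-- A ROW FIELD with row rates `a`: the direction-`1` link at `x` carries the phase
`Σ_{r < x₀} a r` accumulated along direction `0`; direction-`0` links are `1`. [folklore] -/
def rowField (a : ℕ → ℝ) : GaugeConfig 2 L Circle := fun e =>
  if e.2 = 1 then Circle.exp (∑ r ∈ Finset.range (e.1 0).val, a r) else 1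

omit [NeZero L] in
/-- Horizontal links of a row field are trivial. [folklore] -/
theorem rowField_horiz (a : ℕ → ℝ) (x : Site 2 L) : rowField a (x, 0) = 1 := by
  dsimp only [rowField]
  rw [if_neg (show (0 : Fin 2) ≠ 1 by decide)]

omit [NeZero L] in
/-- Vertical links of a row field carry the accumulated phase. [folklore] -/
theorem rowField_vert (a : ℕ → ℝ) (x : Site 2 L) :
    rowField a (x, 1) = Circle.exp (∑ r ∈ Finset.range (x 0).val, a r) := by
  dsimp only [rowField]
  rw [if_pos rfl]

omit [NeZero L] in
/-- **The plaquettes of a row field**: `e^{i a(x₀)}` on row `x₀` (the rates sum to zero over a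
period, so the wrap-around row is consistent). [folklore] -/
theorem plaquetteHolonomy_rowField (hL : 1 < L) {a : ℕ → ℝ} (ha : ∑ r ∈ Finset.range L, a r = 0)
    (x : Site 2 L) : plaquetteHolonomy (rowField a) x 0 1 = Circle.exp (a (x 0).val) := by
  haveI : Fact (1 < L) := ⟨hL⟩
  have h00 : (x.shift 0) 0 = x 0 + 1 := by simp [Site.shift]
  have h10 : (x.shift 1) 0 = x 0 := by simp [Site.shift]
  have hval := val_add_one_eq (x 0)
  have e2 : rowField a (x.shift 0, 1) = Circle.exp (∑ r ∈ Finset.range (x 0 + 1).val, a r) := by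
    rw [rowField_vert, h00]
  have e3 : rowField a (x.shift 1, 0) = 1 := rowField_horiz a _
  rw [plaquetteHolonomy, rowField_horiz, e2, e3, rowField_vert, hval, one_mul, inv_one, mul_one,
    ← Circle.exp_neg, ← Circle.exp_add]
  congr 1
  split_ifs with h
  · have hs := Finset.sum_range_succ a (x 0).val
    rw [← h] at hs
    rw [Finset.sum_range_zero]
    linarith
  · rw [Finset.sum_range_succ]; ring

omit [NeZero L] in
/-- The field tensor of a row field with rates in the principal branch. [folklore] -/
theorem abelianFieldTensor_rowField (hL : 1 < L) {a : ℕ → ℝ} (ha : ∑ r ∈ Finset.range L, a r = 0)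
    (hb : ∀ r, -π < a r ∧ a r ≤ π) (x : Site 2 L) :
    abelianFieldTensor (rowField a) x 0 1 = a (x 0).val :=
  abelianFieldTensor_eq_of_plaquette_eq_exp (plaquetteHolonomy_rowField hL ha x) (hb _).1 (hb _).2

/-- **Charge of a row-like field tensor**: if `F(x) = g(x₀)` depends on the row only, then
`Q = L·(Σ_{v<L} g v)/2π`. [folklore] -/
theorem topCharge_of_row {U : GaugeConfig 2 L Circle} {g : ℕ → ℝ}
    (hU : ∀ x : Site 2 L, abelianFieldTensor U x 0 1 = g (x 0).val) :
    topCharge (0 : Site 2 L) 0 1 U = L * (∑ v ∈ Finset.range L, g v) / (2 * π) := by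
  have hcoord : ∀ s t : ZMod L,
      ((0 : Site 2 L) + Pi.single (0 : Fin 2) s + Pi.single (1 : Fin 2) t : Site 2 L) 0 = s := by
    intro s t; simp
  unfold topCharge magneticFlux
  simp only [hU, hcoord, Finset.sum_const, Finset.card_univ, ZMod.card, nsmul_eq_mul]
  rw [← Finset.mul_sum, sum_zmod_val g]

/-- **A row field has flux charge zero** (its rates telescope over a period). [folklore] -/
theorem topCharge_rowField (hL : 1 < L) {a : ℕ → ℝ} (ha : ∑ r ∈ Finset.range L, a r = 0)
    (hb : ∀ r, -π < a r ∧ a r ≤ π) : topCharge (0 : Site 2 L) 0 1 (rowField a) = 0 := by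
  rw [topCharge_of_row (abelianFieldTensor_rowField hL ha hb), ha, mul_zero, zero_div]

omit [NeZero L] in
/-- Two configurations `B` and `B * W` agree wherever `W` is trivial. [folklore] -/
theorem mul_apply_eq_of_eq_one {G : Type*} [Group G] (B W : GaugeConfig 2 L G) {e : Edge 2 L}
    (h : W e = 1) : B e = (B * W) e := by
  rw [Pi.mul_apply, h, mul_one]

omit [NeZero L] in
/-- A configuration whose plaquettes are `e^{i g(x)}` with `|g| ≤ m ≤ π` is `2 sin(m/2)`-thin.
[folklore] -/
theorem dist_plaquette_le_of_eq_exp {U : GaugeConfig 2 L Circle} {g : Site 2 L → ℝ} {m : ℝ}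
    (hU : ∀ x : Site 2 L, plaquetteHolonomy U x 0 1 = Circle.exp (g x)) (hg : ∀ x, |g x| ≤ m)
    (hm : m ≤ π) (p : Plaquette 2 L) :
    dist (plaquetteHolonomy U p.1 p.2.1.1 p.2.1.2) 1 ≤ 2 * Real.sin (m / 2) := by
  obtain ⟨h0, h1⟩ := plaquette_dirs_eq p
  rw [h0, h1, hU]
  exact dist_exp_one_le_of_abs_le (hg _) hm

end Row

end Summit.Ventures.LatticeQCDFlow.Theory2.Lattice.Flux
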